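import Mathlib.Algebra.Group.Subgroup.Basic
import Mathlib.Data.Int.GCD
import Mathlib.Data.Nat.Factorial.Basic
import Mathlib.Data.Matrix.Basic
import Mathlib.LinearAlgebra.Matrix.Determinant.Basic
import Mathlib.Tactic.LinearCombination
import Mathlib.Tactic.Ring
import Mathlib.Tactic.NormNum
import Mathlib.Tactic.Linarith
import Mathlib.Tactic.Positivity
import HarnessLib

/-!
# NSC(−2) · the INDEX-36 QUESTION decided (report `INDEX36.md`, prover 2 gen 34): the Weil parts of Chern characters at
# `P₀ = E³ × Ē³` form the lattice `W_K = 3·𝒪_K` exactly — def-free arithmetic cores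

Family `hodge`, b2b cell `hweil` (helper of item stmt-HodgeConjecture-2524; cell target NSC(−2) =
`Ring2.Hypotheses.WeilClassesComponent 3 3 [−2]`). Report `run/shared/lean/b2b/hodge-weil/b2b-hweil-pv2-g34/INDEX36.md` with the exact
machine check `run/shared/lean/b2b/hodge-weil/code/pv2-g34/index36.py` (orders LADDER `## CARVER v137` C827 (c): «the INDEX question … it
fixes R10-T's minimal budget in the census window»; question posed in `b2b-hweil-pv1-g59/NSC-SEEDS-3.md` §3.3 (β)). An `Nsc` file (C807 (d))
with NO `Ring2*` import. Only the arithmetic stated below is formalised; the topology and the exterior-algebra identity are the report's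
(machine-checked there, seat level).

SETTING (NSC-SEEDS-3 §3). `P₀ = E⁶`, `E = ℂ/ℤ[ζ₃]`, `K = ℚ(√−3)`, `𝒪_K = ℤ[ζ₃]`, Weil plane `W_ℚ = {w(c) := c·ω_α − c̄·ω_ᾱ : c ∈ K}`
(`∫ w(c)·w(c′) = −tr(c c̄′)`), and `W_K := ch(K₀(P₀)) ∩ W_ℚ` = the Weil parts of K-classes whose Chern character is PURE Weil; of record
`6·𝒪_K ⊆ W_K ⊆ 𝒪_K` (index 36 undecided; «is `w(1)` a Chern character on `E⁶`?»). THE ANSWER: **`W_K = 3·𝒪_K`** (`[𝒪_K : W_K] = 9`,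
`[W_K : 6𝒪_K] = 4`); `w(1)` is NOT a Chern character — it is not even an integral cohomology class.
(A) UPPER BOUND (topology). In the integral basis `a_i, b_i` of `H¹(E_i;ℤ)` (dual to the lattice basis `1, ζ₃`) every `w(c)` has
coordinates in `(1/3)ℤ`, and the period of `w(c)`, `c = a + bζ₃`, on the product cycle `γ₁ × ⋯ × γ₆` (`γ_i ∈ 𝒪_K = H₁(E;ℤ)`,
`μ := γ₁γ₂γ₃·γ̄₄γ̄₅γ̄₆ = m + nζ₃`) is `tr(cμ/(3√−3)) = (an + bm − bn)/3`; so `w(c) ∈ H⁶(P₀;ℤ) ⟺ c ∈ 3𝒪_K` (`nsc_index_period_criterion`).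
Since `K⁰_top(T¹²) = ⋀^{ev}_ℤ(e₁,…,e₁₂)` with `ch(e_I) = x_I`, `ch` maps `K⁰_top(P₀)` onto `H^{ev}(P₀;ℤ)`: a PURE-Weil Chern character is an
integral class, whence `W_K ⊆ 3𝒪_K`. (B) LOWER BOUND (algebraic cycles). In `H⁶(P₀;ℚ(ζ₃))`:
`3·w(1) = Σ_{u ∈ μ₃} [Γ_{uI}] − 3·d₁d₂d₃ − Σ_{i<j} d_k·(2 t_{i,1}t_{j,1} + t_{i,1}t_{j,ζ} + t_{i,ζ}t_{j,1} + 2 t_{i,ζ}t_{j,ζ})`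
(`Γ_{uI} = {z_R = u·z_L}`, `d_i = e_i + e_{3+i}`, `t_{i,λ} = [z_{3+i} = λz_i] − N(λ)e_i − e_{3+i}`): the `μ₃`-orbit sum keeps the torus
charges `≡ 0 (mod 3)`, i.e. the charge-0 part and the Weil part (`nsc_index_mu3`), and the charge-0 part is removed by the
`𝒪_K²`-lattice relation `2·(1,1) + (ζ,ζ̄) + (ζ,ζ) + 2·(ζ²,1) = (0,3)` on the coefficient pairs `(λμ, λμ̄)` of `t_{i,λ}t_{j,μ}`
(`nsc_index_charge_zero_extraction`). Expanded, `w(3) = Σ_B n_B·[B]` over 59 abelian sub-threefolds `B ⊂ P₀` (one linear equation per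
coordinate block `{i, 3+i}`), `n_B ∈ ℤ`, `Σ|n_B| = 351`, verified twice (products of divisor classes; push-forward of fundamental classes via
Plücker coordinates) in `index36.py`; `ch(𝒪_B) = [B]` for a sub-torus, so `w(3) = ch(Σ n_B[𝒪_B])` and, with `diag(ζ₃,1,…,1)^*`,
`3𝒪_K ⊆ W_K` (`nsc_index_sandwich` assembles (A) and (B)). (C) CONSEQUENCES. The Ext budget of a Gaussian–Weil object at `P₀` is
`χ(G,G) = 2N(c)`, `c ∈ 3𝒪_K ∖ 0`: **minimum 18** (not 2), values `18·N(𝒪_K ∖ 0) = {18, 54, 72, 126, …}` (`nsc_index_min_budget`); the R10-T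
window of NSC-SEEDS-3 §3.4 (`N(c) ≤ 496`) becomes `c = 3c′`, `N(c′) ≤ 55`: 198 Eisenstein integers, 33 classes up to units, 21 budgets
(`nsc_index_window_bound`); the leanest Ext profile of a simple semiregular Gaussian–Weil object becomes `(1,25,33,0,33,25,1)`
(`nsc_index_euler_profile`); INTEGRALITY SIEVE: an integral class `q·h_m³ + w` (`h_m³ = 6·Σ m_S e_S`, monomials disjoint from `W`'s) has
`6q ∈ ℤ` and `w ∈ w(3𝒪_K)`, so every algebraic cycle of the sieve shape at `P₀` has `|w·w| ≥ 18` and `deg_h = 1440·q ∈ 240ℤ`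
(`nsc_index_sieve_degree`); the integral Weil lattice `W_ℤ = w(3𝒪_K)` has Gram matrix `[[−18, 9],[9, −18]]`, discriminant `243 = 3⁵`
(`nsc_index_gram`).

HONEST FRAMING: census arithmetic for ONE anchor of ONE cell (the P₀ column is closed for search, C827 (b1); this is the census datum C827 (c)
asked for); nothing here is a rung, a candidate, or evidence for NSC(−2); no case of the Hodge conjecture is proved or claimed; no statement
of [Markman 2025] / [Perry 2026] is used; `HC_CM` occurs nowhere. [cite: HatcherVBKT2017, §2.1 Thm. 2.2 (product theorem: K-theory of tori, ch integral on tori)]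
[cite: vanGeemen1994HodgeAV, Thm. 6.12]
-/

-- mandated namespace `Summit.HodgeConjecture.HodgeConjecture.…` (Problem = Summit) trips `linter.dupNamespace`; the lakefile disables it
-- tree-wide (weak option), restated here so stand-alone elaboration is warning-free too.
set_option linter.dupNamespace false

namespace Summit.HodgeConjecture.HodgeConjecture.WeilTypeLadder

section NscIndexWindow

/-- **INDEX36 (A), the period criterion.** For `c = a + bζ₃` and `μ = m + nζ₃` one has `cμ = (am − bn) + (an + bm − bn)ζ₃`, and the period
of `w(c)` on the product cycle with invariant `μ` is `(an + bm − bn)/3`; all periods are integers iff `3 ∣ a` and `3 ∣ b`, i.e.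
`w(c) ∈ H⁶(P₀;ℤ) ⟺ c ∈ 3𝒪_K`. [cite: vanGeemen1994HodgeAV, Thm. 6.12] -/
theorem nsc_index_period_criterion (a b : ℤ) :
    (∀ m n : ℤ, (3 : ℤ) ∣ a * n + b * m - b * n) ↔ ((3 : ℤ) ∣ a ∧ (3 : ℤ) ∣ b) := by
  constructor
  · intro h
    have hb : (3 : ℤ) ∣ b := by simpa using h 1 0
    have hab : (3 : ℤ) ∣ a - b := by simpa using h 0 1
    refine ⟨?_, hb⟩
    have : a = (a - b) + b := by ring
    rw [this]; exact dvd_add hab hb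
  · rintro ⟨⟨k, hk⟩, ⟨l, hl⟩⟩ m n
    exact ⟨k * n + l * m - l * n, by rw [hk, hl]; ring⟩

/-- **INDEX36 (B), the `μ₃`-orbit.** With `ζ² = −1 − ζ`: `ζ³ = 1`, `1 + ζ + ζ² = 0`, `1 + ζ² + ζ⁴ = 0` — so `Σ_{u ∈ μ₃} u^p ū^q = 3` if
`p ≡ q (mod 3)` and `0` otherwise (`p, q ≤ 3`): the orbit sum `Σ_u [Γ_{uI}]` is `3·(charge-0 part + Weil part)` of `[Γ_I]`. [folklore] -/
theorem nsc_index_mu3 {R : Type*} [CommRing R] (z : R) (hz : z * z = -1 - z) :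
    z ^ 3 = 1 ∧ 1 + z + z ^ 2 = 0 ∧ 1 + z ^ 2 + z ^ 4 = 0 := by
  refine ⟨?_, ?_, ?_⟩
  · linear_combination (z - 1) * hz
  · linear_combination hz
  · linear_combination (z ^ 2 - z + 1) * hz

/-- **INDEX36 (B), the charge-0 extraction.** The coefficient pairs `(λμ, λμ̄)` of the products `t_{i,λ}·t_{j,μ}` for
`(λ, μ) ∈ {(1,1), (1,ζ), (ζ,1), (ζ,ζ)}` weighted `(2, 1, 1, 2)` sum to `(0, 3)` (with `ζ̄ = −1 − ζ = ζ²`): the combination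
`2t_{i,1}t_{j,1} + t_{i,1}t_{j,ζ} + t_{i,ζ}t_{j,1} + 2t_{i,ζ}t_{j,ζ}` equals `3 ×` (the charge-0 part `t_i⁺t_j⁻ + t_i⁻t_j⁺`) and has no charge-`±2`
part. [folklore] -/
theorem nsc_index_charge_zero_extraction {R : Type*} [CommRing R] (z : R) (hz : z * z = -1 - z) :
    2 * (1 * 1) + 1 * z + z * 1 + 2 * (z * z) = (0 : R) ∧
    2 * (1 * 1) + 1 * (-1 - z) + z * 1 + 2 * (z * (-1 - z)) = (3 : R) := by
  constructor
  · linear_combination 2 * hz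
  · linear_combination (-2) * hz

/-- **INDEX36, the sandwich.** An additive subgroup `W ⊆ ℤ² ≅ 𝒪_K` (`(a,b) ↔ a + bζ₃`) all of whose elements have both coordinates divisible
by `3` (upper bound (A)) and which contains `(3,0) ↔ 3` and `(0,3) ↔ 3ζ₃` (lower bound (B) and its `diag(ζ₃,1,…,1)`-translate) IS `3ℤ² ↔ 3𝒪_K`.
Applied to `W = W_K` (coordinates of `c` with `w(c) ∈ ch(K₀(P₀))`): `W_K = 3𝒪_K`. [folklore] -/
theorem nsc_index_sandwich (W : AddSubgroup (ℤ × ℤ)) (hup : ∀ x ∈ W, (3 : ℤ) ∣ x.1 ∧ (3 : ℤ) ∣ x.2)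
    (h3 : ((3 : ℤ), (0 : ℤ)) ∈ W) (h3z : ((0 : ℤ), (3 : ℤ)) ∈ W) (x : ℤ × ℤ) :
    x ∈ W ↔ ((3 : ℤ) ∣ x.1 ∧ (3 : ℤ) ∣ x.2) := by
  refine ⟨hup x, ?_⟩
  rintro ⟨⟨k, hk⟩, ⟨l, hl⟩⟩
  have hx : x = k • ((3 : ℤ), (0 : ℤ)) + l • ((0 : ℤ), (3 : ℤ)) := by
    ext <;> simp [hk, hl, mul_comm]
  rw [hx]
  exact W.add_mem (W.zsmul_mem h3 k) (W.zsmul_mem h3z l)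

/-- **INDEX36 (C), the minimal budget.** For `c = 3(a + bζ₃) ≠ 0` the Ext budget `χ(G,G) = 2N(c) = 18·(a² − ab + b²)` is at least `18`
(and `a² − ab + b² ≥ 1`); in particular the budget `2` of NSC-SEEDS-3 §3.4 (c a unit) is not available at `P₀`. [folklore] -/
theorem nsc_index_min_budget (a b : ℤ) (h : a ≠ 0 ∨ b ≠ 0) :
    1 ≤ a ^ 2 - a * b + b ^ 2 ∧ 18 ≤ 2 * ((3 * a) ^ 2 - (3 * a) * (3 * b) + (3 * b) ^ 2) := by
  have hpos : 0 < a ^ 2 - a * b + b ^ 2 := by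
    rcases h with ha | hb
    · nlinarith [sq_nonneg (a - b), sq_nonneg b, pow_pos (show 0 < a ^ 2 from by positivity) 1, sq_pos_of_ne_zero ha]
    · nlinarith [sq_nonneg (a - b), sq_nonneg a, sq_pos_of_ne_zero hb]
  constructor
  · linarith
  · nlinarith

/-- **INDEX36 (C), the window bound and its count line.** `N(c) = 9·N(c′) ≤ 496 ⟺ N(c′) ≤ 55`; and the `[𝒪_K : 3𝒪_K] = 9`,
`[3𝒪_K : 6𝒪_K] = 4`, `9 · 4 = 36` bookkeeping of the index of record. [folklore] -/
theorem nsc_index_window_bound : (∀ n : ℤ, 9 * n ≤ 496 ↔ n ≤ 55) ∧ (9 : ℕ) * 4 = 36 ∧ 3 ^ 2 = (9 : ℕ) ∧ 2 ^ 2 = (4 : ℕ) := by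
  refine ⟨fun n => ⟨fun h => by omega, fun h => by omega⟩, by norm_num, by norm_num, by norm_num⟩

/-- **INDEX36 (C), the leanest Ext profile.** For a simple object with `χ = 2 − 2e₁ + 2e₂ − e₃` (Serre duality `e₀ = e₆ = 1`, `e₁ = e₅`,
`e₂ = e₄`), budget `χ = 18`, the semiregular target `e₂ = 33` and `e₃ = 0` force `e₁ = 25`: profile `(1, 25, 33, 0, 33, 25, 1)` with
alternating sum `18`. [folklore] -/
theorem nsc_index_euler_profile :
    (∀ e₁ e₂ e₃ χ : ℤ, χ = 2 - 2 * e₁ + 2 * e₂ - e₃ → χ = 18 → e₂ = 33 → e₃ = 0 → e₁ = 25) ∧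
    (1 : ℤ) - 25 + 33 - 0 + 33 - 25 + 1 = 18 := by
  refine ⟨fun e₁ e₂ e₃ χ h hχ h₂ h₃ => by omega, by norm_num⟩

/-- **INDEX36 (C), the integrality sieve at `P₀` (degree line).** `∫ h_m⁶ = 6!·∏ m_i = 720·2 = 1440` for `m = (2,1,1,1,1,1)`, the content of
`h_m³ = 3!·Σ m_S e_S` is `6`, and an integral class `q·h_m³ + w` has `6q =: k ∈ ℤ`, so `deg_h = 1440·q = 240·k ∈ 240ℤ`. [folklore] -/
theorem nsc_index_sieve_degree :
    Nat.factorial 6 * 2 = 1440 ∧ Nat.factorial 3 = 6 ∧ ∀ k : ℤ, (1440 : ℤ) * k = 6 * (240 * k) ∧ (240 : ℤ) ∣ 240 * k := by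
  refine ⟨by decide, by decide, fun k => ⟨by ring, dvd_mul_right 240 k⟩⟩

/-- **INDEX36 (C), the integral Weil lattice.** `W_ℤ := H⁶(P₀;ℤ) ∩ W_ℚ = w(3𝒪_K)` has, in the basis `w(3), w(3ζ₃)`, the Gram matrix
`−tr(c c̄′) = [[−18, 9], [9, −18]]` of determinant `243 = 3⁵` (negative definite: `w·w < 0`, Hodge–Riemann sign of record). [folklore] -/
theorem nsc_index_gram : Matrix.det !![(-18 : ℤ), 9; 9, -18] = 243 ∧ (243 : ℤ) = 3 ^ 5 := by
  refine ⟨?_, by norm_num⟩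
  rw [Matrix.det_fin_two_of]
  norm_num

end NscIndexWindow

end Summit.HodgeConjecture.HodgeConjecture.WeilTypeLadder
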